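import Mathlib
import HarnessLib
import Summits.PneNP.PneNP.Theorems.AeaCutRectanglesToftFooling
import Summits.PneNP.PneNP.Theses.AeaCutRectangles

/-!
# Route AeaCutRectangles — BC5 rung of the deciding crux `FoolingMeasure` (stmt-PneNP-19727):
# THE FIXED-CUT FOOLING MEASURE IN FULL (AEA.md Prop. 5.1 / Thm. 4.2 CLAIM), with X1's asymptotic bound
# (file 4 of 4; files 1–3: `AeaCutRectanglesTransversalEngine`, `…ToftSystem`, `…ToftFooling`)

Main theorem (`foolingMeasure_fixedCut`, sorry-free):

  `∀ C : ℕ, ∃ᶠ n in atTop, ∃ μ : Finset (Sym2 (Fin n)) → ℝ, (μ ≥ 0) ∧ (∑ μ = 1) ∧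
     (supp μ ⊆ loopless NON-3-COLOURABLE edge sets) ∧
     ∃ B : Finset (Fin n), 2 * |B| = n ∧ ∀ 𝓐 𝓑 (cut rectangle over B inside NON-3-COL, X1's typing verbatim),
       ∑_((α,β) ∈ 𝓐 × 𝓑) μ (α ∪ β) ≤ 2 ^ (-(n/2)·log₂ n - C·n)`

i.e. X1 `Summit.PneNP.PneNP.Theses.AeaCutRectangles.FoolingMeasure` with its `∀ B` (every near-balanced cut)
replaced by `∃ B` (ONE exactly balanced cut) — every other clause, and the bound, letter for letter (here
`n = 10(2^k + 1)`, all `k ≥ 10C + 40`, measure = the transported uniform transversal measure of the Toft system,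
`(n/2)·log₂ n + C·n ≤ L²`: `exponent_le`).  What separates the rung from X1 is precisely the SPREAD condition
(AEA.md (D3_ε), §5–6): ONE unit system beating EVERY near-bisection at once.  This file makes that precise:
* `foolingMeasure_of_spreadSystem` — the SPREAD REDUCTION: (∃ ε … ∀ C, ∃ᶠ n, ∃ a unit system on `Fin n` with
  2-edge units, D1, D2 and SPREAD — every near-balanced `B` splits `≥ (n/2)·log₂ n + C·n` units) →
  `Summit.PneNP.PneNP.Theses.AeaCutRectangles.FoolingMeasure` (X1 provers owe exactly that combinatorial
  hypothesis; a support lemma, displayed `closure.modulo` X1's own decl);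
* `toft_not_spread` — the Toft system is split by NO unit at the balanced cut `a ∪ b ∪ b' ∪ p_b ∪ p'_b` (blocks
  `0,2,3,4,5`): the class-atomic-bisection obstruction of AEA.md Prop. 6.2 in its simplest form; AEA.md records
  why the other known candidates fail too (odd-wheel / blow-up systems: `O(n)` crossing units at the worst
  bisection) — that, and nothing in these files, is the open mathematics of X1.

HONEST FRAMING: elementary finite combinatorics (Toft 1970-type critical graphs, a hybrid/fooling argument,
bookkeeping of an explicit measure); FRONTIER material for a rung of Fagin's complement ladder (NON-3-COL vs.
ESO(∀∃∀, arity 2)); nothing here bears on P vs NP, and the summit stays where it was.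

Sources: programme archive 2001, pnp/generalized-spectra-complement/work/aea/AEA.md Def. 4.1, Thm. 4.2, Prop. 5.1,
§6; blind-check records bc-aea-rectangles (B)(D), bc-aea-cut37; B. Toft, "On the maximal number of edges of
critical k-chromatic graphs", Studia Sci. Math. Hungar. 5 (1970) 461–470 (the dense 4-critical graphs).
-/

set_option linter.dupNamespace false -- `Summit.PneNP.PneNP.…`: summit = sub-problem name (D-0017 single-conjunct layout)

namespace Summit.PneNP.PneNP.Theorems.AeaCutRectanglesFixedCutFooling

open Finset
open Summit.PneNP.PneNP.Theorems.AeaCutRectanglesTransversalEngine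

/-! ### Arithmetic of the exponent -/

/-- `7k ≤ 2^k` for `k ≥ 6`. -/
theorem seven_mul_le_two_pow {k : ℕ} (hk : 6 ≤ k) : 7 * k ≤ 2 ^ k := by
  induction k, hk using Nat.le_induction with
  | base => norm_num
  | succ k hk ih =>
    have h7 : 7 ≤ 2 ^ k := le_trans (by omega : 7 ≤ 7 * k) ih
    calc 7 * (k + 1) = 7 * k + 7 := by ring
      _ ≤ 2 ^ k + 2 ^ k := Nat.add_le_add ih h7
      _ = 2 ^ (k + 1) := by ring

/-- The exponent comparison behind the rung: `(n/2)·log₂ n + C·n ≤ L²` for `n = 10L` once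
`log₂(10L) ≤ k + 4` and `5(k + 4 + 2C) ≤ L`. -/
theorem exponent_le {L k C : ℕ} (hlog : Real.logb 2 (10 * L : ℝ) ≤ k + 4) (hcore : 5 * (k + 4 + 2 * C) ≤ L) :
    (10 * L : ℝ) / 2 * Real.logb 2 (10 * L : ℝ) + C * (10 * L : ℝ) ≤ (L : ℝ) * L := by
  have hL0 : (0 : ℝ) ≤ L := Nat.cast_nonneg _
  have h1 : (10 * L : ℝ) / 2 * Real.logb 2 (10 * L : ℝ) ≤ 5 * L * (k + 4) := by
    have h : (10 * L : ℝ) / 2 = 5 * L := by ring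
    rw [h]
    exact mul_le_mul_of_nonneg_left hlog (by positivity)
  have h2 : (5 * (k + 4 + 2 * C) : ℝ) ≤ L := by exact_mod_cast hcore
  nlinarith

/-! ### The rung, in X1's binder shape with `∃ B` (one balanced cut) in place of `∀ B` -/

/-- **BC5 rung of X1 `FoolingMeasure` — the fixed-cut fooling measure in full (AEA.md Prop. 5.1).**
For every `C`, for infinitely many `n` (here `n = 10(2^k + 1)`, all large `k`), there is a probability measure
`μ` on loopless NON-3-COLOURABLE edge sets over `Fin n` and ONE exactly balanced cut `B` (`2|B| = n`) such that
every cut rectangle `𝓐 ⊗ 𝓑` over `B` inside NON-3-COL has `μ`-mass `≤ 2^{-(n/2)·log₂ n - C·n}` — X1's four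
clauses letter for letter, with `∃ B` (one cut) replacing X1's `∀ B` over the near-balanced window.  What separates
this rung from X1 is exactly the SPREAD (D3_ε): one unit system beating every near-bisection simultaneously. -/
theorem foolingMeasure_fixedCut (C : ℕ) : ∃ᶠ n in Filter.atTop, ∃ μ : Finset (Sym2 (Fin n)) → ℝ,
    (∀ S, 0 ≤ μ S) ∧ (∑ S, μ S = 1) ∧
    (∀ S, μ S ≠ 0 → (∀ e ∈ S, ¬ e.IsDiag) ∧ ¬ (SimpleGraph.fromEdgeSet (S : Set (Sym2 (Fin n)))).Colorable 3) ∧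
    ∃ B : Finset (Fin n), 2 * B.card = n ∧
      ∀ 𝓐 𝓑 : Finset (Finset (Sym2 (Fin n))),
        (∀ α ∈ 𝓐, ∀ e ∈ α, ¬ e.IsDiag ∧ ∃ v ∈ e, v ∉ B) →
        (∀ β ∈ 𝓑, ∀ e ∈ β, ¬ e.IsDiag ∧ ∀ v ∈ e, v ∈ B) →
        (∀ α ∈ 𝓐, ∀ β ∈ 𝓑,
          ¬ (SimpleGraph.fromEdgeSet ((α ∪ β : Finset (Sym2 (Fin n))) : Set (Sym2 (Fin n)))).Colorable 3) →
        ∑ q ∈ 𝓐 ×ˢ 𝓑, μ (q.1 ∪ q.2) ≤ (2 : ℝ) ^ (-((n : ℝ) / 2 * Real.logb 2 n) - (C : ℝ) * n) := by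
  rw [Filter.frequently_atTop]
  intro N
  obtain ⟨k, hkN, hkC, hk6⟩ : ∃ k, N ≤ k ∧ 10 * C + 40 ≤ k ∧ 6 ≤ k :=
    ⟨N + 10 * C + 40, by omega, by omega, by omega⟩
  set L : ℕ := 2 ^ k + 1 with hL
  have h2k : 2 ≤ 2 ^ k :=
    calc 2 = 2 ^ 1 := by norm_num
      _ ≤ 2 ^ k := Nat.pow_le_pow_right (by norm_num) (by omega)
  have h7 := seven_mul_le_two_pow hk6
  have hLodd : Odd L := by
    rw [hL]
    exact (Nat.even_pow.2 ⟨even_two, by omega⟩).add_one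
  have hL3 : 3 ≤ L := by omega
  refine ⟨10 * L, by omega, ?_⟩
  obtain ⟨h0, h1, hs, hcard, hr⟩ := toft_fooling hLodd hL3
  let e : Vx L ≃ Fin (10 * L) := finProdFinEquiv
  obtain ⟨μ', h0', h1', hs', hr'⟩ :=
    transport e (mu (frame L) (unit L)) (cut L) ((1 / 2 : ℝ) ^ (L * L)) h0 h1 hs hr
  refine ⟨μ', h0', h1', hs', (cut L).map e.toEmbedding, ?_, ?_⟩
  · rw [Finset.card_map, hcard]
    ring
  · intro 𝓐 𝓑 h𝓐 h𝓑 hN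
    refine (hr' 𝓐 𝓑 h𝓐 h𝓑 hN).trans ?_
    -- the exponent estimate
    have hLpos : (0 : ℝ) < L := by exact_mod_cast (show 0 < L by omega)
    have h16 : (10 * L : ℝ) ≤ (2 : ℝ) ^ (k + 4) := by
      have h : 10 * L ≤ 2 ^ (k + 4) := by
        rw [pow_add]
        norm_num
        omega
      exact_mod_cast h
    have hlog : Real.logb 2 (10 * L : ℝ) ≤ k + 4 := by
      have h := Real.logb_le_logb_of_le (b := 2) (by norm_num) (by linarith) h16
      rw [Real.logb_pow, Real.logb_self_eq_one (by norm_num), mul_one] at h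
      exact_mod_cast h
    have hcore : 5 * (k + 4 + 2 * C) ≤ L := by omega
    have hexp := exponent_le hlog hcore
    have hcast : ((10 * L : ℕ) : ℝ) = 10 * (L : ℝ) := by push_cast; ring
    rw [hcast]
    calc ((1 : ℝ) / 2) ^ (L * L) = (2 : ℝ) ^ (-((L : ℝ) * L)) := by
          rw [Real.rpow_neg (by norm_num), ← Nat.cast_mul, Real.rpow_natCast, one_div, inv_pow]
      _ ≤ (2 : ℝ) ^ (-(10 * (L : ℝ) / 2 * Real.logb 2 (10 * (L : ℝ))) - (C : ℝ) * (10 * (L : ℝ))) :=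
          Real.rpow_le_rpow_of_exponent_le (by norm_num) (by linarith)

/-! ### The spread reduction -/

/-- exponent step: `x ≤ s` ⇒ `(1/2)^s ≤ 2^(-x)`. -/
theorem half_pow_le_two_rpow_neg {s : ℕ} {x : ℝ} (hs : x ≤ s) : (1 / 2 : ℝ) ^ s ≤ (2 : ℝ) ^ (-x) := by
  calc ((1 : ℝ) / 2) ^ s = (2 : ℝ) ^ (-(s : ℝ)) := by
        rw [Real.rpow_neg (by norm_num), Real.rpow_natCast, one_div, inv_pow]
    _ ≤ (2 : ℝ) ^ (-x) := Real.rpow_le_rpow_of_exponent_le (by norm_num) (by linarith)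

/-- **SPREAD REDUCTION.**  The existence of SPREAD unit systems with D1 and D2 (all clauses typed over existing
declarations: `tg`, `gammaMinus` of the transversal engine) implies X1
`Summit.PneNP.PneNP.Theses.AeaCutRectangles.FoolingMeasure` — with the same `ε`, the same `C ↦ n` schedule, and the
measure `mu W π`.  (A reduction / support lemma: X1 provers now owe exactly the hypothesis.) -/
theorem foolingMeasure_of_spreadSystem
    (h : ∃ ε : ℝ, 0 < ε ∧ ε ≤ 1 / 4 ∧ ∀ C : ℕ, ∃ᶠ n in Filter.atTop,
      ∃ (m : ℕ) (W : Finset (Sym2 (Fin n))) (π : Fin m → Finset (Sym2 (Fin n))),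
        (∀ i, (π i).card = 2) ∧
        (∀ t : Fin m → Sym2 (Fin n), (∀ i, t i ∈ π i) →
          (∀ e ∈ tg W t, ¬ e.IsDiag) ∧
            ¬ (SimpleGraph.fromEdgeSet (↑(tg W t) : Set (Sym2 (Fin n)))).Colorable 3) ∧
        (∀ i, (SimpleGraph.fromEdgeSet (↑(gammaMinus W π i) : Set (Sym2 (Fin n)))).Colorable 3) ∧
        ∀ B : Finset (Fin n), (1 / 2 - ε) * (n : ℝ) ≤ B.card → (B.card : ℝ) ≤ (1 / 2 + ε) * n →
          ∃ I : Finset (Fin m), (n : ℝ) / 2 * Real.logb 2 n + (C : ℝ) * n ≤ I.card ∧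
            ∀ i ∈ I, (∃ e ∈ π i, ∀ v ∈ e, v ∈ B) ∧ (∃ e ∈ π i, ∃ v ∈ e, v ∉ B)) :
    Summit.PneNP.PneNP.Theses.AeaCutRectangles.FoolingMeasure := by
  obtain ⟨ε, hε0, hε1, hC⟩ := h
  refine ⟨ε, hε0, hε1, fun C => ?_⟩
  refine (hC C).mono fun n hn => ?_
  obtain ⟨m, W, π, h2, hD1, hD2, hspread⟩ := hn
  refine ⟨mu W π, fun S => mu_nonneg W π S, mu_sum W (fun i => ?_), fun S hS => ?_, ?_⟩
  · rw [← Finset.card_pos, h2 i]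
    norm_num
  · obtain ⟨t, ht, rfl⟩ := mu_support hS
    exact hD1 t ht
  · intro B hB1 hB2 𝓐 𝓑 h𝓐 h𝓑 hN
    obtain ⟨I, hIcard, hI⟩ := hspread B hB1 hB2
    refine (rect_mass_le_half_pow h2 hD2 I hI 𝓐 𝓑 h𝓐 h𝓑 hN).trans ?_
    rw [show -((n : ℝ) / 2 * Real.logb 2 n) - (C : ℝ) * n = -((n : ℝ) / 2 * Real.logb 2 n + (C : ℝ) * n) by ring]
    exact half_pow_le_two_rpow_neg hIcard

/-! ### The Toft system is not spread -/

/-- The balanced cut `a ∪ b ∪ b' ∪ p_b ∪ p'_b` (blocks `0, 2, 3, 4, 5`) has `5L` of the `10L` vertices. -/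
theorem flat_blocks_card (L : ℕ) :
    (univ.filter fun v : Vx L => v.1 = 0 ∨ v.1 = 2 ∨ v.1 = 3 ∨ v.1 = 4 ∨ v.1 = 5).card = 5 * L := by
  have h : (univ.filter fun v : Vx L => v.1 = 0 ∨ v.1 = 2 ∨ v.1 = 3 ∨ v.1 = 4 ∨ v.1 = 5) =
      (univ.filter fun k : Fin 10 => k = 0 ∨ k = 2 ∨ k = 3 ∨ k = 4 ∨ k = 5) ×ˢ (univ : Finset (Fin L)) := by
    ext ⟨k, i⟩
    simp
  have h5 : (univ.filter fun k : Fin 10 => k = 0 ∨ k = 2 ∨ k = 3 ∨ k = 4 ∨ k = 5).card = 5 := by decide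
  rw [h, card_product, h5, card_univ, Fintype.card_fin]

/-- **The Toft system is NOT spread**: the balanced cut `a ∪ b ∪ b' ∪ p_b ∪ p'_b` (blocks `0, 2, 3, 4, 5`; `5L` of
the `10L` vertices, `flat_blocks_card`) splits NO unit — no unit edge lies inside it (every unit edge has its
`c`/`c'` end in block 6 or 7), so at this bisection the engine's bound is `(1/2)^0 = 1`.  SPREAD (beating every
near-bisection at once) is exactly what X1 needs beyond these files. -/
theorem toft_not_spread {L : ℕ} (u : Fin L × Fin L) :
    ¬ ∃ e ∈ unit L u, ∀ v ∈ e, v.1 = 0 ∨ v.1 = 2 ∨ v.1 = 3 ∨ v.1 = 4 ∨ v.1 = 5 := by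
  rintro ⟨e, he, hin⟩
  rcases mem_unit.1 he with rfl | rfl
  · have h := hin (vx 6 u.2) (Sym2.mem_mk_right _ _)
    simp [vx] at h
  · have h := hin (vx 7 u.2) (Sym2.mem_mk_right _ _)
    simp [vx] at h

end Summit.PneNP.PneNP.Theorems.AeaCutRectanglesFixedCutFooling
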